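import Literature.Probability.Percolation.NearCriticalScalingLeaves
import Literature.Probability.Percolation.NearCriticalOneArmFromAltFacts
import HarnessLib

/-!
# `θ(p) ≍ π₁(L(p))` and Cor. 41 from Kesten's relation for ANY four-arm kernel (proofs only)

Topic `Literature/Probability/Percolation`; family `crit-perc`. PROOFS ONLY (no definition, no
named fact). Sequel of `CharLengthEquivalence.lean`, `KestenScalingThetaFromTwoFacts.lean` and
`NearCriticalScalingLeaves.lean` for the named fact
`Literature.Probability.Percolation.Nolin2008_theta_asymp` (`KestenScaling.lean`; P. Nolin,
*Near-critical percolation in two dimensions*, Electron. J. Probab. 13 (2008), §7.4, eq. (7.25)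
[arXiv 0711.4948: the display following Cor. 39]: "for `p > 1/2`,
`θ(p) ≍ P_p[0 ⇝ ∂S_{L(p)}] ≍ P_{1/2}[0 ⇝ ∂S_{L(p)}]`", for every fixed `ε ∈ (0, 1/2)`).

## Why a kernel-generic assembly

`Nolin2008_theta_asymp` at EVERY `ε ∈ (0, 1/2)` is (upper half) the near-critical one-arm
stability below `L(p)` (Nolin's Thm. 27 for `j = 1` / Werner's Lecture 6, §5; needed at small `ε`
only, `KestenScalingThetaProofs.lean`) and (lower half) Cor. 41 at every `ε`, which the printed
proof gets from the small-`ε` case (RSW; PROVED, `Nolin2008_cor41_at_holds_small`) through the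
equivalence of lengths Cor. 37 [arXiv Cor. 35], `L_ε(p) ≍ L_{ε'}(p)`, whose proof (arXiv p. 26) is
the chain

  `|p - 1/2| L_ε² π₄(L_ε) ≤ C` (Kesten, at `ε`), `c ≤ |p - 1/2| L_{ε'}² π₄(L_{ε'})` (at `ε'`),
  `π₄(L_ε) ≥ c_Q π₄(L_{ε'}) π₄(4 L_{ε'}, L_ε)` (quasi-multiplicativity),
  `π₄(4 L_{ε'}, L_ε) ≥ c_L (4 L_{ε'} / L_ε)^{2-β}` (a priori bound from five arms)
  `⟹ (L_ε / L_{ε'})^β ≤ C'`.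

This chain is pure real arithmetic in the four-arm KERNEL `π₄(·, ·)` (`CharLengthEquivalence.core`):
it holds verbatim for any non-negative `Q : ℕ → ℕ → ℝ` that is quasi-multiplicative, obeys the
a priori lower bound, and for which the two ONE-SIDED Kesten bounds hold. The tree states Kesten's
relation with the order-free critical kernel `critFourArmProb` (`Nolin2008_prop34`,
`Werner2009_kestenRelationW`), whose discharge runs through the order-free near-critical facts
`Werner2009_fourArm_quasiMult` / `Werner2009_pivotal_lowerBound` (one separation hypothesis away:
`Nolin2008_theta_asymp_of_separation`, `NearCriticalScalingFromSeparation.lean`); in parallel the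
tree develops the same calculus for Werner's ALTERNATING kernel `π̂^alt = altFourArmProbAt`
(`AltFourArm.lean`, `NearCriticalOneArmFromAltFacts.lean`: `Nolin2008_thm27_oneArm_of_altHyps`,
`Werner2009_oneArm_nearCritical_of_altHyps`), which is the kernel of Kesten (1987, (1.12)), Nolin
(`σ = BWBW`) and Werner (`π̂_p`) and needs arm separation for one colour sequence only. This file
makes the last two steps of the discharge of `Nolin2008_theta_asymp` independent of that choice:

* `charLength_le_mul_charLength_of_kernel` — **Cor. 37 for a kernel**: `L_ε(p) ≤ K · L_{ε'}(p)`
  (`0 < ε ≤ ε' < 1/2`, `p ≠ 1/2` near `1/2`) from the upper Kesten bound at `ε`, the lower Kesten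
  bound at `ε'` (both with kernel `Q`), quasi-multiplicativity and the a priori bound for `Q`;
* `charLength_lengths_of_kernel` — the hypothesis `hlen` of the tree's `…_of_lengths` theorems for
  every `ε₀` below the threshold of the upper bounds: upper Kesten bounds are needed at SMALL `ε`
  only, lower Kesten bounds at EVERY `ε ∈ (0, 1/2)` (this is where `ε` close to `1/2` enters);
* `Nolin2008_cor41_of_small_lengths` — Cor. 41 from `hlen` restricted to small `ε₀` (the RSW
  threshold of `Nolin2008_lemma39_small_holds` can always be lowered);
* `Nolin2008_cor41_of_kernel`, `Nolin2008_theta_asymp_of_kernel`,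
  `Nolin2008_theta_asymp_of_thm27_of_kernel` — **Cor. 41 and `θ(p) ≍ π₁(L_ε(p))` for every `ε`
  from the one-sided Kesten bounds for any kernel** (plus the one-arm stability for the upper
  half of `θ_asymp`);
* `critAltFourArmProb_quasiMult`, `critAltFourArmProb_lowerBound` — the `t = 1/2` instances of the
  alternating near-critical hypotheses of `NearCriticalOneArmFromAltFacts.lean`;
* `Nolin2008_theta_asymp_of_altHyps` — **the ALTERNATING route**: `Nolin2008_theta_asymp` from the
  three alternating hypotheses of `Nolin2008_thm27_oneArm_of_altHyps` (quasi-multiplicativity,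
  a priori bound, interior pivotal lower bound for `π̂^alt` below `L(p)`) and the two one-sided
  Kesten bounds with the critical alternating kernel `π̂^alt_{1/2}(r₀, L_ε(p))`;
* an `example`: at `Q = critFourArmProb` the kernel theorem gives back
  `Nolin2008_cor41_of_scaling` (`NearCriticalScalingLeaves.lean`).

Everything is proved; no `sorry`, no new definition, no new named fact (D-0026). The discharge
`Nolin2008_theta_asymp_holds` is `Nolin2008_theta_asymp_of_separation` (order-free route) or
`Nolin2008_theta_asymp_of_altHyps` (alternating route) applied to the corresponding theorems once
the arm-separation programme (`ArmSeparation*.lean`, Nolin's Thm. 11 for `j = 4` below `L(p)`)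
delivers them.

## References

* P. Nolin, Near-critical percolation in two dimensions, *Electron. J. Probab.* 13 (2008)
  1562–1623, §7.3 Prop. 34 and Cor. 37 (proof), §7.4 Lemma 39, Remark 40, Cor. 41, eq. (7.25),
  §6.1 Thm. 27 (arXiv 0711.4948: Prop. 32, Cor. 35, Lemma 37, Remark 38, Cor. 39, Thm. 26)
  [Nolin2008].
* H. Kesten, Scaling relations for 2D-percolation, *Comm. Math. Phys.* 109 (1987) 109–156, (1.12),
  (4.5), Thm. 2 [KestenScalingCMP1987].
* W. Werner, *Lectures on two-dimensional critical percolation*, IAS/Park City Math. Ser. 16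
  (2009), Lecture 6, §3–§5, Cor. 6.2, Lemma 6.2, Cor. 6.3 [WernerPCMI2009].

Tree: `CharLengthEquivalence.core`, `critFourArmProb_quasiMult`, `critFourArmProb_lowerBound`
(`CharLengthEquivalence.lean`), `Nolin2008_lemma39_small_holds` (`NearCriticalScalingLeaves.lean`),
`Nolin2008_lemma39_of_small_of_lengths` (`NearCriticalScalingProofs.lean`),
`Nolin2008_cor41_of_ladder` (`NearCriticalArm.lean`), `Nolin2008_theta_asymp_of_oneArm_nearCritical`
(`KestenScalingThetaProofs.lean`), `Nolin2008_theta_asymp_of_nearCritical`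
(`NearCriticalScaling.lean`), `Werner2009_oneArm_nearCritical_of_altHyps`
(`NearCriticalOneArmFromAltFacts.lean`), `altFourArmProbAt` (`AltFourArm.lean`),
`le_charLength_eventually`, `charLength_anti`, `charLength_symm`, `tri_rsw_half_holds`,
`Nolin2008_subcritical_crossing_holds`, `BollobasRiordan2006_ch5_lemma7_holds`. Mathlib: `Real.rpow`.
-/

noncomputable section

open Filter Topology MeasureTheory Set
open scoped unitInterval

namespace Literature.Probability.Percolation

open LatticeModels

/-! ### Cor. 37 for a kernel -/

/-- **Equivalence of lengths, non-trivial inequality, for any four-arm kernel** (Nolin 2008,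
§7.3, Cor. 37 [arXiv 0711.4948: Cor. 35], proof): let `Q : ℕ → ℕ → ℝ` be non-negative,
quasi-multiplicative (`c · Q(r, R) · Q(4R, S) ≤ Q(r, S)` for `r₁ ≤ r`, `16 r < 4R < S`) and obey the
a priori bound `c · (m/n)^{2-β} ≤ Q(m, n)` (`r₁ ≤ m ≤ n`). If for every large inner radius `r₀`
the UPPER Kesten bound `|p - 1/2| L_ε(p)² Q(r₀, L_ε(p)) ≤ C` holds at `ε` and the LOWER one
`c ≤ |p - 1/2| L_{ε'}(p)² Q(r₀, L_{ε'}(p))` at `ε'` (`0 < ε ≤ ε' < 1/2`, each on a punctured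
neighbourhood of `1/2`), then `L_ε(p) ≤ K · L_{ε'}(p)` for `p ≠ 1/2` near `1/2`. The proof is the
printed chain of displays (`CharLengthEquivalence.core` with `A = L_ε(p)`, `B = L_{ε'}(p) > 4 r₀`,
in the case `4B < A`; otherwise `K = 4`); the case `Q = critFourArmProb` is
`charLength_le_mul_charLength_at`. [cite: Nolin2008, §7.3, Cor. 37 (arXiv 0711.4948: Cor. 35)] -/
theorem charLength_le_mul_charLength_of_kernel {Q : ℕ → ℕ → ℝ} {ε ε' : ℝ} (hε : 0 < ε)
    (hεε' : ε ≤ ε') (hε' : ε' < 1 / 2) (hQ0 : ∀ m n, 0 ≤ Q m n)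
    (hQM : ∃ r₁ : ℕ, ∃ c > (0 : ℝ), ∀ r R S : ℕ, r₁ ≤ r → 16 * r < 4 * R → 4 * R < S →
      c * (Q r R * Q (4 * R) S) ≤ Q r S)
    (hLB : ∃ r₁ : ℕ, ∃ β > (0 : ℝ), ∃ c > (0 : ℝ), ∀ m n : ℕ, r₁ ≤ m → m ≤ n →
      c * ((m : ℝ) / n) ^ (2 - β) ≤ Q m n)
    (hKup : ∃ r₁ : ℕ, ∀ r₀ ≥ r₁, ∃ δ > (0 : ℝ), ∃ C : ℝ,
      ∀ p : unitInterval, (p : ℝ) ≠ 1 / 2 → |(p : ℝ) - 1 / 2| < δ →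
        |(p : ℝ) - 1 / 2| * (charLength ε p : ℝ) ^ 2 * Q r₀ (charLength ε p) ≤ C)
    (hKlow : ∃ r₁ : ℕ, ∀ r₀ ≥ r₁, ∃ δ > (0 : ℝ), ∃ c > (0 : ℝ),
      ∀ p : unitInterval, (p : ℝ) ≠ 1 / 2 → |(p : ℝ) - 1 / 2| < δ →
        c ≤ |(p : ℝ) - 1 / 2| * (charLength ε' p : ℝ) ^ 2 * Q r₀ (charLength ε' p)) :
    ∃ δ > (0 : ℝ), ∃ K > (0 : ℝ), ∀ p : unitInterval, (p : ℝ) ≠ 1 / 2 → |(p : ℝ) - 1 / 2| < δ →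
      (charLength ε p : ℝ) ≤ K * charLength ε' p := by
  have hsub := Nolin2008_subcritical_crossing_holds
  obtain ⟨rQ, cQ, hcQ, hQ⟩ := hQM
  obtain ⟨rL, β, hβ, cL, hcL, hL⟩ := hLB
  obtain ⟨r₁, hr₁⟩ := hKup
  obtain ⟨r₁', hr₁'⟩ := hKlow
  set r₀ : ℕ := max (max r₁ r₁') (max rQ rL)
  obtain ⟨δ₁, hδ₁, C₁, hb₁⟩ := hr₁ r₀ ((le_max_left _ _).trans (le_max_left _ _))
  obtain ⟨δ₂, hδ₂, c₂, hc₂, hb₂⟩ := hr₁' r₀ ((le_max_right _ _).trans (le_max_left _ _))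
  have hrQ : rQ ≤ r₀ := (le_max_left _ _).trans (le_max_right _ _)
  have hrL : rL ≤ r₀ := (le_max_right _ _).trans (le_max_right _ _)
  -- `L_{ε'}(p) ≥ 4 r₀ + 1` near `1/2` (Nolin's Prop. 4)
  obtain ⟨δ₃, hδ₃, h₃⟩ := le_charLength_eventually BollobasRiordan2006_ch5_lemma7_holds hsub
    (hε.trans_le hεε') hε' (4 * r₀ + 1)
  set K : ℝ := max 4 ((C₁ / (c₂ * cQ * cL * (4 : ℝ) ^ (2 - β))) ^ β⁻¹)
  refine ⟨min (min δ₁ δ₂) δ₃, lt_min (lt_min hδ₁ hδ₂) hδ₃, K, lt_max_of_lt_left (by norm_num),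
    fun p hp hpδ => ?_⟩
  have hpδ₁ : |(p : ℝ) - 1 / 2| < δ₁ := hpδ.trans_le ((min_le_left _ _).trans (min_le_left _ _))
  have hpδ₂ : |(p : ℝ) - 1 / 2| < δ₂ :=
    hpδ.trans_le ((min_le_left _ _).trans (min_le_right _ _))
  have hpδ₃ : |(p : ℝ) - 1 / 2| < δ₃ := hpδ.trans_le (min_le_right _ _)
  set a : ℕ := charLength ε p
  set b : ℕ := charLength ε' p
  -- `b ≥ 4 r₀ + 1`: below `1/2` directly, above `1/2` through `L(1 - p) = L(p)`
  have hb4 : 4 * r₀ + 1 ≤ b := by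
    rcases lt_or_gt_of_ne hp with hlt | hgt
    · exact h₃ p (by linarith [(abs_lt.1 hpδ₃).1]) hlt
    · have hq1 : 1 / 2 - δ₃ < ((σ p : unitInterval) : ℝ) := by
        rw [unitInterval.coe_symm_eq]; linarith [(abs_lt.1 hpδ₃).2]
      have hq2 : ((σ p : unitInterval) : ℝ) < 1 / 2 := by
        rw [unitInterval.coe_symm_eq]; linarith
      have h := h₃ (σ p) hq1 hq2
      rwa [charLength_symm] at h
  have hba : b ≤ a := charLength_anti hsub hε hεε' hp
  have hA : (0 : ℝ) < a := by exact_mod_cast (show 0 < a by omega)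
  have hB : (0 : ℝ) < b := by exact_mod_cast (show 0 < b by omega)
  have hx : 0 < |(p : ℝ) - 1 / 2| := abs_pos.2 (sub_ne_zero.2 hp)
  have hK₁ := hb₁ p hp hpδ₁
  have hK₂ := hb₂ p hp hpδ₂
  rcases le_or_gt a (4 * b) with hle | hlt
  · -- `a ≤ 4 b`
    calc (a : ℝ) ≤ 4 * b := by exact_mod_cast hle
      _ ≤ K * b := mul_le_mul_of_nonneg_right (le_max_left _ _) hB.le
  · -- `4 b < a`: quasi-multiplicativity across `Λ_a ∖ Λ_{4b}` and the a priori bound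
    have hQ' := hQ r₀ b a hrQ (by omega) hlt
    have hL' : cL * (4 * (b : ℝ) / a) ^ (2 - β) ≤ Q (4 * b) a := by
      have h := hL (4 * b) a (by omega) hlt.le
      rwa [Nat.cast_mul, Nat.cast_ofNat] at h
    have hcore := CharLengthEquivalence.core hA hB hx.le hc₂ hcQ hcL hβ (hQ0 _ _) (hQ0 _ _)
      hK₁ hK₂ hQ' hL'
    calc (a : ℝ) ≤ (C₁ / (c₂ * cQ * cL * (4 : ℝ) ^ (2 - β))) ^ β⁻¹ * b := hcore
      _ ≤ K * b := mul_le_mul_of_nonneg_right (le_max_right _ _) hB.le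

/-- **The equivalence of lengths in the shape consumed by the tree, for any kernel** (Nolin 2008,
§7.3, Cor. 37 [arXiv 0711.4948: Cor. 35], as used in the proof of Lemma 39 [arXiv Lemma 37]: "the
result for any `ε ∈ (0, 1/2)` follows readily by using the equivalence of lengths"): given a
non-negative quasi-multiplicative kernel `Q` with the a priori bound, UPPER Kesten bounds
`|p - 1/2| L_ε² Q(r₀, L_ε) ≤ C` for every `ε` below some `ε₁ > 0` and LOWER Kesten bounds
`c ≤ |p - 1/2| L_ε² Q(r₀, L_ε)` for EVERY `ε ∈ (0, 1/2)`, one has, for all `0 < ε₀ < ε₁` and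
`ε₀ < ε < 1/2`, constants `δ > 0`, `C` with `L_{ε₀}(p) ≤ C · L_ε(p)` for `1/2 - δ < p < 1/2`. [cite: Nolin2008, §7.3, Cor. 37 and §7.4, proof of Lemma 39, last paragraph (arXiv 0711.4948: Cor. 35, Lemma 37)] -/
theorem charLength_lengths_of_kernel {Q : ℕ → ℕ → ℝ} (hQ0 : ∀ m n, 0 ≤ Q m n)
    (hQM : ∃ r₁ : ℕ, ∃ c > (0 : ℝ), ∀ r R S : ℕ, r₁ ≤ r → 16 * r < 4 * R → 4 * R < S →
      c * (Q r R * Q (4 * R) S) ≤ Q r S)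
    (hLB : ∃ r₁ : ℕ, ∃ β > (0 : ℝ), ∃ c > (0 : ℝ), ∀ m n : ℕ, r₁ ≤ m → m ≤ n →
      c * ((m : ℝ) / n) ^ (2 - β) ≤ Q m n)
    {ε₁ : ℝ}
    (hKup : ∀ ⦃ε : ℝ⦄, 0 < ε → ε < ε₁ → ∃ r₁ : ℕ, ∀ r₀ ≥ r₁, ∃ δ > (0 : ℝ), ∃ C : ℝ,
      ∀ p : unitInterval, (p : ℝ) ≠ 1 / 2 → |(p : ℝ) - 1 / 2| < δ →
        |(p : ℝ) - 1 / 2| * (charLength ε p : ℝ) ^ 2 * Q r₀ (charLength ε p) ≤ C)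
    (hKlow : ∀ ⦃ε : ℝ⦄, 0 < ε → ε < 1 / 2 → ∃ r₁ : ℕ, ∀ r₀ ≥ r₁, ∃ δ > (0 : ℝ), ∃ c > (0 : ℝ),
      ∀ p : unitInterval, (p : ℝ) ≠ 1 / 2 → |(p : ℝ) - 1 / 2| < δ →
        c ≤ |(p : ℝ) - 1 / 2| * (charLength ε p : ℝ) ^ 2 * Q r₀ (charLength ε p)) :
    ∀ ⦃ε₀ ε : ℝ⦄, 0 < ε₀ → ε₀ < ε₁ → ε₀ < ε → ε < 1 / 2 →
      ∃ δ > (0 : ℝ), ∃ C : ℝ, ∀ p : unitInterval, 1 / 2 - δ < (p : ℝ) → (p : ℝ) < 1 / 2 →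
        (charLength ε₀ p : ℝ) ≤ C * charLength ε p := by
  intro ε₀ ε hε₀ hε₀₁ hε₀ε hε
  obtain ⟨δ, hδ, K, -, hb⟩ := charLength_le_mul_charLength_of_kernel hε₀ hε₀ε.le hε hQ0 hQM hLB
    (hKup hε₀ hε₀₁) (hKlow (hε₀.trans hε₀ε) hε)
  refine ⟨δ, hδ, K, fun p hp1 hp2 => hb p hp2.ne ?_⟩
  rw [abs_lt]; constructor <;> linarith

/-! ### Cor. 41 and `θ(p) ≍ π₁(L_ε(p))` for every `ε` -/

/-- **Cor. 41 for every `ε` from the equivalence of lengths at small `ε₀`** (Nolin 2008, §7.4,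
Cor. 41 through Lemma 39 / Remark 40 [arXiv 0711.4948: Cor. 39, Lemma 37, Remark 38]): it suffices
to know `L_{ε₀}(p) ≤ C · L_ε(p)` (`p` just below `1/2`) for every `ε₀` below SOME positive
threshold `ε₂` and every `ε ∈ (ε₀, 1/2)` — the RSW threshold `ε₀` of `Nolin2008_lemma39_small_holds`
can be lowered to `min ε₀ (ε₂/2)`, after which `Nolin2008_lemma39_of_small_of_lengths` and
`Nolin2008_cor41_of_ladder` apply as in `Nolin2008_cor41_of_lengths`. [cite: Nolin2008, §7.4, Cor. 41, Lemma 39 and Remark 40 (arXiv 0711.4948: Cor. 39, Lemma 37, Remark 38)] -/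
theorem Nolin2008_cor41_of_small_lengths {ε₂ : ℝ} (hε₂ : 0 < ε₂)
    (hlen : ∀ ⦃ε₀ ε : ℝ⦄, 0 < ε₀ → ε₀ < ε₂ → ε₀ < ε → ε < 1 / 2 →
      ∃ δ > (0 : ℝ), ∃ C : ℝ, ∀ p : unitInterval, 1 / 2 - δ < (p : ℝ) → (p : ℝ) < 1 / 2 →
        (charLength ε₀ p : ℝ) ≤ C * charLength ε p) :
    Nolin2008_cor41 := by
  obtain ⟨ε₀, hε₀, hsmall⟩ := Nolin2008_lemma39_small_holds
  have hε' : 0 < min ε₀ (ε₂ / 2) := lt_min hε₀ (half_pos hε₂)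
  have h39 : Nolin2008_lemma39 :=
    Nolin2008_lemma39_of_small_of_lengths hε'
      (fun ε hε hεle k hk => hsmall hε (hεle.trans (min_le_left _ _)) k hk)
      (fun ε h h' => hlen hε' ((min_le_right _ _).trans_lt (half_lt_self hε₂)) h h')
  exact Nolin2008_cor41_of_ladder tri_rsw_half_holds h39 Nolin2008_subcritical_crossing_holds

/-- **Cor. 41 for every `ε ∈ (0, 1/2)` from the one-sided Kesten bounds for any kernel** (Nolin
2008, §7.4, Cor. 41 with §7.3 Cor. 37 [arXiv 0711.4948: Cor. 39, Cor. 35]): for a non-negative,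
quasi-multiplicative kernel `Q` with the a priori lower bound, upper Kesten bounds at every small
`ε` and lower Kesten bounds at every `ε ∈ (0, 1/2)` (all with kernel `Q`) imply the named fact
`Nolin2008_cor41`. [cite: Nolin2008, §7.4, Cor. 41 and §7.3, Cor. 37 (arXiv 0711.4948: Cor. 39, Cor. 35)] -/
theorem Nolin2008_cor41_of_kernel {Q : ℕ → ℕ → ℝ} (hQ0 : ∀ m n, 0 ≤ Q m n)
    (hQM : ∃ r₁ : ℕ, ∃ c > (0 : ℝ), ∀ r R S : ℕ, r₁ ≤ r → 16 * r < 4 * R → 4 * R < S →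
      c * (Q r R * Q (4 * R) S) ≤ Q r S)
    (hLB : ∃ r₁ : ℕ, ∃ β > (0 : ℝ), ∃ c > (0 : ℝ), ∀ m n : ℕ, r₁ ≤ m → m ≤ n →
      c * ((m : ℝ) / n) ^ (2 - β) ≤ Q m n)
    (hKup : ∃ ε₁ > (0 : ℝ), ∀ ⦃ε : ℝ⦄, 0 < ε → ε < ε₁ → ∃ r₁ : ℕ, ∀ r₀ ≥ r₁, ∃ δ > (0 : ℝ),
      ∃ C : ℝ, ∀ p : unitInterval, (p : ℝ) ≠ 1 / 2 → |(p : ℝ) - 1 / 2| < δ →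
        |(p : ℝ) - 1 / 2| * (charLength ε p : ℝ) ^ 2 * Q r₀ (charLength ε p) ≤ C)
    (hKlow : ∀ ⦃ε : ℝ⦄, 0 < ε → ε < 1 / 2 → ∃ r₁ : ℕ, ∀ r₀ ≥ r₁, ∃ δ > (0 : ℝ), ∃ c > (0 : ℝ),
      ∀ p : unitInterval, (p : ℝ) ≠ 1 / 2 → |(p : ℝ) - 1 / 2| < δ →
        c ≤ |(p : ℝ) - 1 / 2| * (charLength ε p : ℝ) ^ 2 * Q r₀ (charLength ε p)) :
    Nolin2008_cor41 := by
  obtain ⟨ε₁, hε₁, hup⟩ := hKup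
  exact Nolin2008_cor41_of_small_lengths hε₁ (charLength_lengths_of_kernel hQ0 hQM hLB hup hKlow)

/-- **`θ(p) ≍ π₁(L_ε(p))` for every `ε` from the one-arm stability and the one-sided Kesten bounds
for any kernel** (Nolin 2008, §7.4, eq. (7.25) [arXiv 0711.4948: the display following Cor. 39]:
`θ(p) ≍ P_p[0 ⇝ ∂S_{L(p)}] ≍ P_{1/2}[0 ⇝ ∂S_{L(p)}]` for `p > 1/2`; Kesten 1987, Thm. 2): the upper
half from Werner's near-critical one-arm stability at small `ε`
(`Nolin2008_theta_asymp_of_oneArm_nearCritical`), the lower half from `Nolin2008_cor41_of_kernel`. [cite: Nolin2008, §7.4, Cor. 41 and eq. (7.25), §7.3 Cor. 37 (arXiv 0711.4948: Cor. 39 and the display following it, Cor. 35)] [cite: KestenScalingCMP1987, Thm. 2] [cite: WernerPCMI2009, Lecture 6, §5 ("End of the proof of the theorem")] -/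
theorem Nolin2008_theta_asymp_of_kernel (h1 : Werner2009_oneArm_nearCritical) {Q : ℕ → ℕ → ℝ}
    (hQ0 : ∀ m n, 0 ≤ Q m n)
    (hQM : ∃ r₁ : ℕ, ∃ c > (0 : ℝ), ∀ r R S : ℕ, r₁ ≤ r → 16 * r < 4 * R → 4 * R < S →
      c * (Q r R * Q (4 * R) S) ≤ Q r S)
    (hLB : ∃ r₁ : ℕ, ∃ β > (0 : ℝ), ∃ c > (0 : ℝ), ∀ m n : ℕ, r₁ ≤ m → m ≤ n →
      c * ((m : ℝ) / n) ^ (2 - β) ≤ Q m n)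
    (hKup : ∃ ε₁ > (0 : ℝ), ∀ ⦃ε : ℝ⦄, 0 < ε → ε < ε₁ → ∃ r₁ : ℕ, ∀ r₀ ≥ r₁, ∃ δ > (0 : ℝ),
      ∃ C : ℝ, ∀ p : unitInterval, (p : ℝ) ≠ 1 / 2 → |(p : ℝ) - 1 / 2| < δ →
        |(p : ℝ) - 1 / 2| * (charLength ε p : ℝ) ^ 2 * Q r₀ (charLength ε p) ≤ C)
    (hKlow : ∀ ⦃ε : ℝ⦄, 0 < ε → ε < 1 / 2 → ∃ r₁ : ℕ, ∀ r₀ ≥ r₁, ∃ δ > (0 : ℝ), ∃ c > (0 : ℝ),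
      ∀ p : unitInterval, (p : ℝ) ≠ 1 / 2 → |(p : ℝ) - 1 / 2| < δ →
        c ≤ |(p : ℝ) - 1 / 2| * (charLength ε p : ℝ) ^ 2 * Q r₀ (charLength ε p)) :
    Nolin2008_theta_asymp :=
  Nolin2008_theta_asymp_of_oneArm_nearCritical h1 (Nolin2008_cor41_of_kernel hQ0 hQM hLB hKup hKlow)

/-- **`θ(p) ≍ π₁(L_ε(p))` for every `ε` from Nolin's Thm. 27 (`j = 1`) and the one-sided Kesten
bounds for any kernel** (Nolin 2008, §7.4, eq. (7.25) with Cor. 41 and §6.1 Thm. 27 [arXiv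
0711.4948: display after Cor. 39; Thm. 26]): as `Nolin2008_theta_asymp_of_kernel`, with the one-arm
stability in Nolin's form (`Nolin2008_theta_asymp_of_nearCritical`). [cite: Nolin2008, §7.4, eq. (7.25), Cor. 41, §6.1 Thm. 27, §7.3 Cor. 37 (arXiv 0711.4948: Cor. 39, Thm. 26, Cor. 35)] -/
theorem Nolin2008_theta_asymp_of_thm27_of_kernel (h27 : Nolin2008_thm27_oneArm) {Q : ℕ → ℕ → ℝ}
    (hQ0 : ∀ m n, 0 ≤ Q m n)
    (hQM : ∃ r₁ : ℕ, ∃ c > (0 : ℝ), ∀ r R S : ℕ, r₁ ≤ r → 16 * r < 4 * R → 4 * R < S →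
      c * (Q r R * Q (4 * R) S) ≤ Q r S)
    (hLB : ∃ r₁ : ℕ, ∃ β > (0 : ℝ), ∃ c > (0 : ℝ), ∀ m n : ℕ, r₁ ≤ m → m ≤ n →
      c * ((m : ℝ) / n) ^ (2 - β) ≤ Q m n)
    (hKup : ∃ ε₁ > (0 : ℝ), ∀ ⦃ε : ℝ⦄, 0 < ε → ε < ε₁ → ∃ r₁ : ℕ, ∀ r₀ ≥ r₁, ∃ δ > (0 : ℝ),
      ∃ C : ℝ, ∀ p : unitInterval, (p : ℝ) ≠ 1 / 2 → |(p : ℝ) - 1 / 2| < δ →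
        |(p : ℝ) - 1 / 2| * (charLength ε p : ℝ) ^ 2 * Q r₀ (charLength ε p) ≤ C)
    (hKlow : ∀ ⦃ε : ℝ⦄, 0 < ε → ε < 1 / 2 → ∃ r₁ : ℕ, ∀ r₀ ≥ r₁, ∃ δ > (0 : ℝ), ∃ c > (0 : ℝ),
      ∀ p : unitInterval, (p : ℝ) ≠ 1 / 2 → |(p : ℝ) - 1 / 2| < δ →
        c ≤ |(p : ℝ) - 1 / 2| * (charLength ε p : ℝ) ^ 2 * Q r₀ (charLength ε p)) :
    Nolin2008_theta_asymp :=
  Nolin2008_theta_asymp_of_nearCritical h27 (Nolin2008_cor41_of_kernel hQ0 hQM hLB hKup hKlow)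

/-- Sanity check (the order-free critical kernel): at `Q = critFourArmProb`, with both one-sided
bounds read off `Nolin2008_prop34` and the two four-arm facts at `t = 1/2`, the kernel theorem is
the tree's `Nolin2008_cor41_of_scaling` (`NearCriticalScalingLeaves.lean`). -/
example (hK : Nolin2008_prop34) (hQM : Werner2009_fourArm_quasiMult)
    (hLB : Werner2009_fourArm_lowerBound) : Nolin2008_cor41 := by
  refine Nolin2008_cor41_of_kernel (Q := critFourArmProb) (fun _ _ => measureReal_nonneg)
    (critFourArmProb_quasiMult hQM) (critFourArmProb_lowerBound hLB) ⟨1 / 2, one_half_pos, ?_⟩ ?_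
  · intro ε hε hε'
    obtain ⟨r₁, hr₁⟩ := hK hε hε'
    refine ⟨r₁, fun r₀ hr₀ => ?_⟩
    obtain ⟨δ, hδ, c, -, C, hb⟩ := hr₁ r₀ hr₀
    exact ⟨δ, hδ, C, fun p hp hpδ => (hb p hp hpδ).2⟩
  · intro ε hε hε'
    obtain ⟨r₁, hr₁⟩ := hK hε hε'
    refine ⟨r₁, fun r₀ hr₀ => ?_⟩
    obtain ⟨δ, hδ, c, hc, C, hb⟩ := hr₁ r₀ hr₀
    exact ⟨δ, hδ, c, hc, fun p hp hpδ => (hb p hp hpδ).1⟩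

/-! ### The alternating route -/

/-- **Quasi-multiplicativity of the critical ALTERNATING four-arm probability** (Werner 2009,
Lecture 6, Cor. 6.2 at `p = 1/2`; Nolin 2008, Prop. 17 for `σ = BWBW` [arXiv 0711.4948:
Prop. 16]; Kesten 1987): the instance `t = 1/2` of the alternating quasi-multiplicativity
hypothesis of `Nolin2008_thm27_oneArm_of_altHyps` (`NearCriticalOneArmFromAltFacts.lean`), where the
restriction `S ≤ L(t, ε)` is void — there are `r₁` and `c > 0` with
`c · π̂^alt_{1/2}(r, R) · π̂^alt_{1/2}(4R, S) ≤ π̂^alt_{1/2}(r, S)` for `r₁ ≤ r`, `16 r < 4R < S`. [cite: WernerPCMI2009, Lecture 6, Cor. 6.2] [cite: Nolin2008, Prop. 17 (arXiv 0711.4948: Prop. 16)] -/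
theorem critAltFourArmProb_quasiMult
    (hQM : ∃ ε₁ > (0 : ℝ), ∀ ⦃ε : ℝ⦄, 0 < ε → ε < ε₁ →
      ∃ r₁ : ℕ, ∃ δ > (0 : ℝ), ∃ c > (0 : ℝ),
        ∀ t : unitInterval, 1 / 2 ≤ (t : ℝ) → (t : ℝ) < 1 / 2 + δ →
          ∀ r R S : ℕ, r₁ ≤ r → 16 * r < 4 * R → 4 * R < S →
            (1 / 2 < (t : ℝ) → S ≤ charLengthW ε t) →
              c * (altFourArmProbAt t r R * altFourArmProbAt t (4 * R) S) ≤ altFourArmProbAt t r S) :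
    ∃ r₁ : ℕ, ∃ c > (0 : ℝ), ∀ r R S : ℕ, r₁ ≤ r → 16 * r < 4 * R → 4 * R < S →
      c * (altFourArmProbAt half r R * altFourArmProbAt half (4 * R) S) ≤
        altFourArmProbAt half r S := by
  obtain ⟨ε₁, hε₁, h⟩ := hQM
  obtain ⟨r₁, δ, hδ, c, hc, hb⟩ := h (half_pos hε₁) (half_lt_self hε₁)
  exact ⟨r₁, c, hc, fun r R S hr hR hS => hb half coe_half.ge (by rw [coe_half]; linarith) r R S
    hr hR hS (fun hlt => absurd hlt (by rw [coe_half]; exact lt_irrefl _))⟩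

/-- **A priori lower bound for the critical ALTERNATING four-arm probability, exponent `< 2`**
(Werner 2009, Lecture 6, §3, third estimate, at `p = 1/2`; Nolin 2008, proof of Cor. 37: "the
a-priori bound for `4` arms given by the `5`-arm exponent"): the instance `t = 1/2` of the
alternating a priori hypothesis of `Nolin2008_thm27_oneArm_of_altHyps` — there are `r₁`, `β > 0`,
`c > 0` with `c · (m/n)^{2-β} ≤ π̂^alt_{1/2}(m, n)` for `r₁ ≤ m ≤ n`. [cite: WernerPCMI2009, Lecture 6, §3 (third a priori estimate)] [cite: Nolin2008, §7.3, proof of Cor. 37 (arXiv 0711.4948: Cor. 35)] -/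
theorem critAltFourArmProb_lowerBound
    (hLB : ∃ ε₁ > (0 : ℝ), ∀ ⦃ε : ℝ⦄, 0 < ε → ε < ε₁ →
      ∃ r₁ : ℕ, ∃ δ > (0 : ℝ), ∃ β > (0 : ℝ), ∃ c > (0 : ℝ),
        ∀ t : unitInterval, 1 / 2 ≤ (t : ℝ) → (t : ℝ) < 1 / 2 + δ →
          ∀ m n : ℕ, r₁ ≤ m → m ≤ n → (1 / 2 < (t : ℝ) → n ≤ charLengthW ε t) →
            c * ((m : ℝ) / n) ^ (2 - β) ≤ altFourArmProbAt t m n) :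
    ∃ r₁ : ℕ, ∃ β > (0 : ℝ), ∃ c > (0 : ℝ), ∀ m n : ℕ, r₁ ≤ m → m ≤ n →
      c * ((m : ℝ) / n) ^ (2 - β) ≤ altFourArmProbAt half m n := by
  obtain ⟨ε₁, hε₁, h⟩ := hLB
  obtain ⟨r₁, δ, hδ, β, hβ, c, hc, hb⟩ := h (half_pos hε₁) (half_lt_self hε₁)
  exact ⟨r₁, β, hβ, c, hc, fun m n hm hmn => hb half coe_half.ge (by rw [coe_half]; linarith) m n
    hm hmn (fun hlt => absurd hlt (by rw [coe_half]; exact lt_irrefl _))⟩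

/-- **`θ(p) ≍ π₁(L_ε(p))` for every `ε`, the ALTERNATING route** (Nolin 2008, §7.4, eq. (7.25)
[arXiv 0711.4948: the display following Cor. 39], Cor. 41, Cor. 37, Prop. 34, Thm. 27 (`j = 1`);
Kesten 1987, Thm. 2 with the alternating four-arm event (1.12); Werner 2009, Lecture 6 with
`π̂_p` the alternating four-arm probability): `Nolin2008_theta_asymp` follows from

* the three alternating hypotheses of `Nolin2008_thm27_oneArm_of_altHyps` — quasi-multiplicativity
  of `π̂^alt = altFourArmProbAt` below `L(p)` (Werner's Cor. 6.2; Nolin's Prop. 17, `σ = BWBW`),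
  the a priori bound `c (m/n)^{2-β} ≤ π̂^alt_t(m, n)` (Werner §3, third estimate) and the interior
  pivotal lower bound `c π̂^alt_t(r₀, N) ≤ P_t(v pivotal for LR(2N, N))` (Werner, proof of
  Lemma 6.2), which give the one-arm stability (`Werner2009_oneArm_nearCritical_of_altHyps`) and,
  at `t = 1/2`, the two critical inputs of Cor. 37;
* the two ONE-SIDED Kesten bounds with the critical alternating kernel: the upper bound
  `|p - 1/2| L_ε(p)² π̂^alt_{1/2}(r₀, L_ε(p)) ≤ C` at every small `ε`, and the lower bound
  `c ≤ |p - 1/2| L_ε(p)² π̂^alt_{1/2}(r₀, L_ε(p))` at every `ε ∈ (0, 1/2)` (the two halves of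
  Nolin's Prop. 34 [arXiv Prop. 32] for `σ = BWBW`; Werner's display after Lemma 6.3).

No separation statement for the adjacent colour arrangement and no colour switching enter this
route. [cite: Nolin2008, §7.4, eq. (7.25), Cor. 41; §7.3, Prop. 34, Cor. 37; §6.1, Thm. 27 (arXiv 0711.4948: Cor. 39, Prop. 32, Cor. 35, Thm. 26)] [cite: KestenScalingCMP1987, (1.12), (4.5), Thm. 2] [cite: WernerPCMI2009, Lecture 6, Cor. 6.2, Lemma 6.2, display after Lemma 6.3, §5] -/
theorem Nolin2008_theta_asymp_of_altHyps
    (hQM : ∃ ε₁ > (0 : ℝ), ∀ ⦃ε : ℝ⦄, 0 < ε → ε < ε₁ →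
      ∃ r₁ : ℕ, ∃ δ > (0 : ℝ), ∃ c > (0 : ℝ),
        ∀ t : unitInterval, 1 / 2 ≤ (t : ℝ) → (t : ℝ) < 1 / 2 + δ →
          ∀ r R S : ℕ, r₁ ≤ r → 16 * r < 4 * R → 4 * R < S →
            (1 / 2 < (t : ℝ) → S ≤ charLengthW ε t) →
              c * (altFourArmProbAt t r R * altFourArmProbAt t (4 * R) S) ≤ altFourArmProbAt t r S)
    (hLB : ∃ ε₁ > (0 : ℝ), ∀ ⦃ε : ℝ⦄, 0 < ε → ε < ε₁ →
      ∃ r₁ : ℕ, ∃ δ > (0 : ℝ), ∃ β > (0 : ℝ), ∃ c > (0 : ℝ),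
        ∀ t : unitInterval, 1 / 2 ≤ (t : ℝ) → (t : ℝ) < 1 / 2 + δ →
          ∀ m n : ℕ, r₁ ≤ m → m ≤ n → (1 / 2 < (t : ℝ) → n ≤ charLengthW ε t) →
            c * ((m : ℝ) / n) ^ (2 - β) ≤ altFourArmProbAt t m n)
    (hP : ∃ ε₁ > (0 : ℝ), ∀ ⦃ε : ℝ⦄, 0 < ε → ε < ε₁ →
      ∃ r₁ : ℕ, ∀ r₀ ≥ r₁, ∃ n₁ : ℕ, ∃ δ > (0 : ℝ), ∃ c > (0 : ℝ),
        ∀ t : unitInterval, 1 / 2 ≤ (t : ℝ) → (t : ℝ) < 1 / 2 + δ →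
          ∀ N : ℕ, n₁ ≤ N → (1 / 2 < (t : ℝ) → N ≤ charLengthW ε t) →
            ∀ v : Site 2, (N : ℤ) < 4 * v 0 → 4 * v 0 < 7 * N → (N : ℤ) < 4 * v 1 → 4 * v 1 < 3 * N →
              c * altFourArmProbAt t r₀ N ≤
                (triSitePercolation t).real {ω | IsPivotal (triLRCrossing (2 * N) N) v ω})
    (hKup : ∃ ε₁ > (0 : ℝ), ∀ ⦃ε : ℝ⦄, 0 < ε → ε < ε₁ → ∃ r₁ : ℕ, ∀ r₀ ≥ r₁, ∃ δ > (0 : ℝ),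
      ∃ C : ℝ, ∀ p : unitInterval, (p : ℝ) ≠ 1 / 2 → |(p : ℝ) - 1 / 2| < δ →
        |(p : ℝ) - 1 / 2| * (charLength ε p : ℝ) ^ 2 * altFourArmProbAt half r₀ (charLength ε p) ≤ C)
    (hKlow : ∀ ⦃ε : ℝ⦄, 0 < ε → ε < 1 / 2 → ∃ r₁ : ℕ, ∀ r₀ ≥ r₁, ∃ δ > (0 : ℝ), ∃ c > (0 : ℝ),
      ∀ p : unitInterval, (p : ℝ) ≠ 1 / 2 → |(p : ℝ) - 1 / 2| < δ →
        c ≤ |(p : ℝ) - 1 / 2| * (charLength ε p : ℝ) ^ 2 *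
          altFourArmProbAt half r₀ (charLength ε p)) :
    Nolin2008_theta_asymp :=
  Nolin2008_theta_asymp_of_kernel (Werner2009_oneArm_nearCritical_of_altHyps hQM hLB hP)
    (Q := fun r R => altFourArmProbAt half r R) (fun _ _ => altFourArmProbAt_nonneg _ _ _)
    (critAltFourArmProb_quasiMult hQM) (critAltFourArmProb_lowerBound hLB) hKup hKlow

end Literature.Probability.Percolation
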